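import Summits.ABC.StewartYu.ArchG3RecSiegelAtoms
import Mathlib.Analysis.SpecialFunctions.Stirling
import Mathlib.Data.Nat.Choose.Bounds
import HarnessLib

/-!
# Cell abc-stewartyu, rung A1.L (crux r2 `ArchCoreRat`), WP-L.A: the SIEGEL LINE (L1) of the START on the record of reference — the one
# numeric hypothesis of `archLevelStateQ_zero_rec`, discharged n-UNIFORMLY from the closed forms of `ArchG3Rec`

`Summits/ABC/StewartYu/ArchG3RecSiegel.lean` — cell `abc-stewartyu` (HOME `run/shared/lean/pub/abc-stewartyu/`; «lp-1 takes (L1)» STATUS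
2026-08-27 20:3xZ after p1 g11's open offer (r2-a) 19:49:57Z; referee acceptance criterion ref g37 20:09:30Z: n-uniform, Stirling with
`√(2πn)`, a `2^{−n}`-class depth atom — not the `4(Ŝ+2) ≤ L` floor).  Theorems on `ArchG3Rec`; no definition, no named fact.

THE LINE: `2·((2X₀+1)·C(T₀+n−1, n))·(2⌈(Σⱼσⱼ·Aⱼ)/w₀⌉₊+1)·Nⁿ ≤ (L₀+1)·N·∏ⱼ(2⌊N·σⱼ⌋₊+1)`, `X₀ = Nf 0 0 = Xs 0`, `T₀ = Tf 0 0 = Mord 0 0`,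
`w₀ = wl 0 = L·e^{−(G+2)}`, `σⱼ = L/(2Aⱼ)`, `L₀ = ⌈6X·C_bⁿ·Ω·K/N⌉`, `C_b = 2e·c_M = 32e` EXACTLY.  LEDGER (every `n ≥ 1`):
* `Σⱼσⱼ·Aⱼ = nL/2`, `∏ⱼσⱼ = Lⁿ/(2ⁿΩ)`; the class count `2⌈n·e^{G+2}/2⌉₊ + 1 ≤ K + 2` (`K = ⌈n·e^{G+2}⌉₊ + 1`); `Xs 0 ≤ X/2 + 1` (`G = 8(n+1)`);
* `Mord 0 0 ≤ 16(n+1)L·(1 + 1/(n+2)³) + (n+1)·Ŝ` (`R 1 ≤ 8L + Ŝ`, geometric), and the DEPTH ATOM **`n·(Ŝ + 1) ≤ 4L`** from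
  `Ŝ = n + 24 + ⌊log₂(K·N)⌋`, `K ≤ n·e^{8n+10} + 2`, `N ≤ (2/log 2)ⁿ·Ω`, `L ≥ 2^{n+25}` and `L·(1 + log N) ≥ 48·C_bⁿ·Ω·K` (`core_le_L`,
  `yload_K ≥ 2G`, `W/WN ≥ 1/(1 + log N)`), `log Ω ≤ 2√Ω`;
* `C(T₀+n−1, n) ≤ (T₀+n−1)ⁿ/n! ≤ (16e·L)ⁿ·e·e^{nδ}/√(2πn)` (Stirling `√(2πn)(n/e)ⁿ ≤ n!`, `(1+1/n)ⁿ ≤ e`) with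
  `nδ ≤ n/(n+2)³ + n(Ŝ+1)/(16L) ≤ 0.3`, `e^{0.3} ≤ 10/7`;
* `(L₀+1)·N ≥ 6X·C_bⁿ·Ω·K`, `2⌊x⌋₊ + 1 ≥ x`; so RHS `≥ 6XK·Nⁿ·(16e·L)ⁿ` and LHS `≤ 2(X+3)(K+2)·(16e·L)ⁿ·e·(10/7)/2.5·Nⁿ ≤ 3.2·XK·…`.
THIS FILE: `choose_le_stirling`, `one_add_inv_pow_le_exp`, `le_two_floor_add_one`, `four_le_K`, `binom_start_le`, `siegel_rhs_ge`, `siegel_mid_le`,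
**`siegel_line`** (the atoms are `ArchG3RecSiegelAtoms`; the corollary on `archLevelStateQ_zero_rec` is `ArchG3StartClosed`).

WHAT THIS IS NOT: the letter bounds on `AmaxR` (record, seat p1); no crux moves.

References: Yu. V. Nesterenko, LNM 1819 (2003) §3.3 Prop. 3.4, §3.5 (3.22)–(3.24), Prop. 3.9 (the count of the linear system), p. 66–76
[Nesterenko2003]; E. M. Matveev, Izv. Math. 64 (2000) §3 [Matveev2000].
-/

noncomputable section

open Finset Real
open scoped Nat

namespace Summit.ABC.StewartYu

namespace ArchG3Rec

open PadicG3Par (cG cM Cb cG_pos Cb_pos)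
open ArchG3Par (G K SdK yloadK G_eq eight_le_G G_pos one_le_K K_pos two_G_le_yloadK yloadK_pos mul_exp_le_K K_le)

variable {n : ℕ} (P : ArchG3Rec n)

/-! ### The binomial count via Stirling -/

/-- **`C(m, k) ≤ (e·m/k)ᵏ/√(2πk)`** (`k ≥ 1`): `C(m,k) ≤ mᵏ/k!` and Stirling's lower bound `√(2πk)(k/e)ᵏ ≤ k!`. [folklore] -/
theorem choose_le_stirling (m k : ℕ) (hk : 1 ≤ k) :
    ((m.choose k : ℕ) : ℝ) ≤ (exp 1 * m / k) ^ k / √(2 * π * k) := by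
  have h1 : ((m.choose k : ℕ) : ℝ) ≤ (m : ℝ) ^ k / k ! := by
    exact Nat.choose_le_pow_div k m (α := ℝ)
  have hst := Stirling.le_factorial_stirling k
  have hk0 : (0 : ℝ) < k := by exact_mod_cast hk
  have hsq : 0 < √(2 * π * k) := Real.sqrt_pos.mpr (by positivity)
  have hden : 0 < √(2 * π * k) * ((k : ℝ) / exp 1) ^ k := by positivity
  have hfac : (0 : ℝ) < k ! := by exact_mod_cast Nat.factorial_pos k
  have h2 : (m : ℝ) ^ k / k ! ≤ (m : ℝ) ^ k / (√(2 * π * k) * ((k : ℝ) / exp 1) ^ k) :=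
    div_le_div_of_nonneg_left (by positivity) hden hst
  refine h1.trans (h2.trans (le_of_eq ?_))
  rw [div_pow, div_pow, mul_pow]
  field_simp

/-- `(1 + 1/k)ᵏ ≤ e`. [folklore] -/
theorem one_add_inv_pow_le_exp (k : ℕ) (hk : 1 ≤ k) : (1 + 1 / (k : ℝ)) ^ k ≤ exp 1 := by
  have hk0 : (0 : ℝ) < k := by exact_mod_cast hk
  have h1 : 1 + 1 / (k : ℝ) ≤ exp (1 / k) := by have := Real.add_one_le_exp (1 / (k : ℝ)); linarith
  calc (1 + 1 / (k : ℝ)) ^ k ≤ (exp (1 / k)) ^ k := pow_le_pow_left₀ (by positivity) h1 k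
    _ = exp 1 := by rw [← Real.exp_nat_mul]; congr 1; field_simp

/-- `2⌊x⌋₊ + 1 ≥ x` for `x ≥ 0`. [folklore] -/
theorem le_two_floor_add_one {x : ℝ} (_hx : 0 ≤ x) : x ≤ 2 * (⌊x⌋₊ : ℝ) + 1 := by
  rcases le_or_gt 1 x with h | h
  · have := Nat.lt_floor_add_one x
    have h1 : (1 : ℝ) ≤ ⌊x⌋₊ := by exact_mod_cast Nat.one_le_floor_iff _ |>.mpr h
    linarith
  · have : (0 : ℝ) ≤ ⌊x⌋₊ := Nat.cast_nonneg _
    linarith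

/-! ### The Siegel line -/

/-- `4 ≤ K` (`K ≥ n·e^{G+2} ≥ e^{G+2} ≥ G + 3 ≥ 11`). [folklore] -/
theorem four_le_K (hn : 1 ≤ n) : (4 : ℝ) ≤ K n := by
  have h := mul_exp_le_K n
  have hexp : G n + 2 + 1 ≤ exp (G n + 2) := Real.add_one_le_exp _
  have hG := eight_le_G n
  have hn1 : (1 : ℝ) ≤ n := by exact_mod_cast hn
  have h1 : exp (G n + 2) ≤ n * exp (G n + 2) := le_mul_of_one_le_left (exp_pos _).le hn1
  linarith

/-- **The binomial of the START via Stirling**: `C(T₀+n−1, n) ≤ (16e·L)ⁿ·(e·10/7)/(5/2)` — `T₀+n−1 ≤ 16(n+1)L(1+δ)`,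
`nδ ≤ n/(n+2)³ + n(Ŝ+1)/(16L) ≤ 3/10` (the depth atom), `(1+1/n)ⁿ ≤ e`, `e^{3/10} ≤ 10/7`, `√(2πn) ≥ 5/2`.
[cite: Nesterenko2003, §3.5 Prop. 3.9 (the count); shape only] -/
theorem binom_start_le : (((P.Tf 0 0 + n - 1).choose n : ℕ) : ℝ) ≤ (16 * exp 1 * P.L) ^ n * (exp 1 * (10 / 7)) / (5 / 2) := by
  have hn1 : 1 ≤ n := P.hn
  have hn : (1 : ℝ) ≤ n := by exact_mod_cast hn1
  have hn0 : (0 : ℝ) < n := by linarith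
  have hL := P.L_real
  have hT₀ : (P.Tf 0 0 : ℝ) ≤ 16 * (n + 1) * P.L * (1 + 1 / ((n : ℝ) + 2) ^ 3) + (n + 1) * P.Sd := P.Mord_zero_le
  have hSd := P.n_mul_Sd_le
  set m : ℕ := P.Tf 0 0 + n - 1 with hm
  have hmR : (m : ℝ) = (P.Tf 0 0 : ℝ) + n - 1 := by
    rw [hm, Nat.cast_sub (by omega), Nat.cast_add]; simp
  have hchoose := choose_le_stirling m n hn1
  set δ : ℝ := 1 / ((n : ℝ) + 2) ^ 3 + ((P.Sd : ℝ) + 1) / (16 * P.L) with hδ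
  have hδ0 : 0 ≤ δ := by positivity
  have hmle : (m : ℝ) ≤ 16 * (n + 1) * P.L * (1 + δ) := by
    rw [hmR, hδ]
    have hL0 := hL.2.1
    have e1 : 16 * ((n : ℝ) + 1) * P.L * (1 + (1 / ((n : ℝ) + 2) ^ 3 + ((P.Sd : ℝ) + 1) / (16 * P.L))) =
        16 * (n + 1) * P.L * (1 + 1 / ((n : ℝ) + 2) ^ 3) + (n + 1) * (P.Sd + 1) := by
      field_simp
      ring
    rw [e1]
    linarith
  have hnδ : (n : ℝ) * δ ≤ 3 / 10 := by
    rw [hδ, mul_add]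
    have h1 : (n : ℝ) * (1 / ((n : ℝ) + 2) ^ 3) ≤ 1 / 25 := by
      rw [← mul_div_assoc, mul_one, div_le_div_iff₀ (by positivity) (by norm_num)]
      nlinarith [sq_nonneg ((n : ℝ) - 1)]
    have h2 : (n : ℝ) * (((P.Sd : ℝ) + 1) / (16 * P.L)) ≤ 1 / 4 := by
      rw [← mul_div_assoc, div_le_div_iff₀ (by linarith [hL.2.1]) (by norm_num)]
      linarith
    linarith
  have hexpδ : (1 + δ) ^ n ≤ 10 / 7 := by
    have h1 : (1 + δ) ^ n ≤ exp (n * δ) := by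
      calc (1 + δ) ^ n ≤ (exp δ) ^ n := pow_le_pow_left₀ (by positivity) (by have := Real.add_one_le_exp δ; linarith) n
        _ = exp (n * δ) := by rw [← Real.exp_nat_mul]
    have h2 : exp ((n : ℝ) * δ) ≤ exp (3 / 10) := Real.exp_le_exp.mpr hnδ
    have h3 : exp ((3 : ℝ) / 10) ≤ 1 / (1 - 3 / 10) := Real.exp_bound_div_one_sub_of_interval (by norm_num) (by norm_num)
    have h4 : (1 : ℝ) / (1 - 3 / 10) = 10 / 7 := by norm_num
    linarith
  have hsqrt : (5 / 2 : ℝ) ≤ √(2 * π * n) := by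
    rw [show (5 / 2 : ℝ) = √((5 / 2) ^ 2) by rw [Real.sqrt_sq (by norm_num)]]
    exact Real.sqrt_le_sqrt (by nlinarith [Real.pi_gt_d2])
  refine hchoose.trans ?_
  have hnum : (exp 1 * m / n) ^ n ≤ (16 * exp 1 * P.L) ^ n * (exp 1 * (10 / 7)) := by
    have h1 : exp 1 * (m : ℝ) / n ≤ (16 * exp 1 * P.L) * ((1 + 1 / (n : ℝ)) * (1 + δ)) := by
      rw [div_le_iff₀ hn0]
      have h2 : exp 1 * (m : ℝ) ≤ exp 1 * (16 * (n + 1) * P.L * (1 + δ)) := mul_le_mul_of_nonneg_left hmle (exp_pos 1).le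
      have e3 : (16 * exp 1 * P.L) * ((1 + 1 / (n : ℝ)) * (1 + δ)) * n = exp 1 * (16 * (n + 1) * P.L * (1 + δ)) := by
        field_simp
      linarith
    have h0 : 0 ≤ exp 1 * (m : ℝ) / n := by positivity
    calc (exp 1 * m / n) ^ n ≤ ((16 * exp 1 * P.L) * ((1 + 1 / (n : ℝ)) * (1 + δ))) ^ n := pow_le_pow_left₀ h0 h1 n
      _ = (16 * exp 1 * P.L) ^ n * ((1 + 1 / (n : ℝ)) ^ n * (1 + δ) ^ n) := by simp only [mul_pow]
      _ ≤ (16 * exp 1 * P.L) ^ n * (exp 1 * (10 / 7)) := by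
          refine mul_le_mul_of_nonneg_left ?_ (by positivity)
          exact mul_le_mul (one_add_inv_pow_le_exp n hn1) hexpδ (by positivity) (exp_pos 1).le
  calc (exp 1 * m / n) ^ n / √(2 * π * n) ≤ (exp 1 * m / n) ^ n / (5 / 2) :=
        div_le_div_of_nonneg_left (by positivity) (by norm_num) hsqrt
    _ ≤ (16 * exp 1 * P.L) ^ n * (exp 1 * (10 / 7)) / (5 / 2) := div_le_div_of_nonneg_right hnum (by norm_num)

/-- **The right-hand side of (L1) from below**: `6X·K·(16e·L)ⁿ·Nⁿ ≤ (L₀+1)·N·∏(2⌊Nσⱼ⌋₊+1)` (`(L₀+1)N ≥ 6X·C_bⁿΩK`, `C_b = 32e`,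
`2⌊x⌋₊+1 ≥ x`, `∏σⱼ = Lⁿ/(2ⁿΩ)`). [cite: Nesterenko2003, §3.5 (3.23); shape only] -/
theorem siegel_rhs_ge : 6 * P.X * K n * (16 * exp 1 * P.L) ^ n * (P.N : ℝ) ^ n ≤
    ((P.L₀ : ℝ) + 1) * ((P.N : ℝ) * ∏ j, (2 * (⌊(P.N : ℝ) * P.σ j⌋₊ : ℝ) + 1)) := by
  have hN := P.N_facts
  have hΩ := P.Ω_facts
  have hL₀ : 6 * P.X * Cb ^ n * P.Ω * K n ≤ ((P.L₀ : ℝ) + 1) * P.N := by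
    have h1 : 6 * P.X * Cb ^ n * P.Ω * K n / P.N ≤ P.L₀ := by unfold ArchG3Rec.L₀; exact Nat.le_ceil _
    rw [div_le_iff₀ hN.1] at h1
    nlinarith [hN.1]
  have hprod : (P.N : ℝ) ^ n * ((P.L : ℝ) ^ n / ((2 : ℝ) ^ n * P.Ω)) ≤ ∏ j, (2 * (⌊(P.N : ℝ) * P.σ j⌋₊ : ℝ) + 1) := by
    rw [← P.prod_σ]
    have e : (P.N : ℝ) ^ n * ∏ j, P.σ j = ∏ j, ((P.N : ℝ) * P.σ j) := by
      rw [prod_mul_distrib, prod_const, card_univ, Fintype.card_fin]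
    rw [e]
    refine prod_le_prod (fun j _ => by have := (P.box_facts j).1; have := hN.1; positivity) fun j _ => ?_
    exact le_two_floor_add_one (by have := (P.box_facts j).1; have := hN.1; positivity)
  have hCb : Cb ^ n = (2 : ℝ) ^ n * (16 * exp 1) ^ n := by rw [← mul_pow, Cb_eq]; ring_nf
  have hΩ0 : P.Ω ≠ 0 := hΩ.1.ne'
  have e1 : 6 * P.X * K n * (16 * exp 1 * P.L) ^ n * (P.N : ℝ) ^ n =
      (6 * P.X * Cb ^ n * P.Ω * K n) * ((P.N : ℝ) ^ n * ((P.L : ℝ) ^ n / ((2 : ℝ) ^ n * P.Ω))) := by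
    rw [hCb, mul_pow]; field_simp
  rw [e1]
  have h0 : (0 : ℝ) ≤ (P.N : ℝ) ^ n * ((P.L : ℝ) ^ n / ((2 : ℝ) ^ n * P.Ω)) := by have := hΩ.1; positivity
  have h0' : (0 : ℝ) ≤ ((P.L₀ : ℝ) + 1) * P.N := by positivity
  calc (6 * P.X * Cb ^ n * P.Ω * K n) * ((P.N : ℝ) ^ n * ((P.L : ℝ) ^ n / ((2 : ℝ) ^ n * P.Ω)))
      ≤ (((P.L₀ : ℝ) + 1) * P.N) * (∏ j, (2 * (⌊(P.N : ℝ) * P.σ j⌋₊ : ℝ) + 1)) :=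
        mul_le_mul hL₀ hprod h0 h0'
    _ = ((P.L₀ : ℝ) + 1) * ((P.N : ℝ) * ∏ j, (2 * (⌊(P.N : ℝ) * P.σ j⌋₊ : ℝ) + 1)) := by ring

/-- The numeric middle of (L1): `2(X+3)·(e·(10/7)/(5/2))·(K+2) ≤ 6XK` (`X ≥ 128`, `K ≥ 4`, `e ≤ 2.72`). [folklore] -/
theorem siegel_mid_le : 2 * ((P.X : ℝ) + 3) * (exp 1 * (10 / 7) / (5 / 2)) * (K n + 2) ≤ 6 * P.X * K n := by
  have hX : (128 : ℝ) ≤ P.X := P.X_floors.2.1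
  have hK4 : (4 : ℝ) ≤ K n := four_le_K P.hn
  have he1 := Real.exp_one_lt_d9
  have hX3 : (P.X : ℝ) + 3 ≤ (131 / 128) * P.X := by linarith
  have hK2 : (K n : ℝ) + 2 ≤ (3 / 2) * K n := by linarith
  have hc : exp 1 * (10 / 7) / (5 / 2) ≤ 8 / 5 := by
    rw [div_le_iff₀ (by norm_num)]; linarith
  have hXK : (0 : ℝ) ≤ P.X * K n := by positivity
  calc 2 * ((P.X : ℝ) + 3) * (exp 1 * (10 / 7) / (5 / 2)) * (K n + 2)
      ≤ 2 * ((131 / 128) * (P.X : ℝ)) * (8 / 5) * ((3 / 2) * (K n : ℝ)) := by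
        have h0 : 0 ≤ exp 1 * (10 / 7) / (5 / 2) := by positivity
        gcongr
    _ = (1572 / 320) * ((P.X : ℝ) * K n) := by ring
    _ ≤ 6 * P.X * K n := by nlinarith

/-- **THE SIEGEL LINE (L1) OF THE START, n-uniformly from the record's closed forms** (`C_b = 32e`; Stirling with `√(2πn)`; the depth atom
`n(Ŝ+1) ≤ 4L` from `core_le_L` — the floor `4(Ŝ+2) ≤ L` is NOT used):
`2·((2X₀+1)·C(T₀+n−1,n))·(2⌈(Σσⱼ·Aⱼ)/w₀⌉₊+1)·Nⁿ ≤ (L₀+1)·N·∏(2⌊Nσⱼ⌋₊+1)`.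
[cite: Nesterenko2003, §3.5 (3.22)–(3.24), Prop. 3.9 (the count of the linear system), p. 71–76] -/
theorem siegel_line : 2 * ((2 * P.Nf 0 0 + 1) * (P.Tf 0 0 + n - 1).choose n) * (2 * ⌈(∑ j, P.σ j * P.A j) / P.wl 0⌉₊ + 1) * P.N ^ n ≤
    (P.L₀ + 1) * (P.N * ∏ j, (2 * ⌊(P.N : ℝ) * P.σ j⌋₊ + 1)) := by
  have hX₀ : (P.Nf 0 0 : ℝ) ≤ P.X / 2 + 1 := by
    have : P.Nf 0 0 = P.Xs 0 := by unfold ArchG3Rec.Nf; simp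
    rw [this]; exact P.Xs_zero_le
  have hKc := P.classCount_le
  have hC := P.binom_start_le
  have hR := P.siegel_rhs_ge
  have hmid := P.siegel_mid_le
  have hA0 : (0 : ℝ) ≤ (16 * exp 1 * P.L) ^ n := by positivity
  have hNn : (0 : ℝ) ≤ (P.N : ℝ) ^ n := by positivity
  have h2X : 2 * (P.Nf 0 0 : ℝ) + 1 ≤ (P.X : ℝ) + 3 := by linarith
  have hc0 : (0 : ℝ) ≤ (((P.Tf 0 0 + n - 1).choose n : ℕ) : ℝ) := Nat.cast_nonneg _
  have hKc0 : (0 : ℝ) ≤ (((2 * ⌈(∑ j, P.σ j * P.A j) / P.wl 0⌉₊ + 1 : ℕ) : ℝ)) := Nat.cast_nonneg _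
  have h1 : 2 * ((2 * (P.Nf 0 0 : ℝ) + 1) * ((((P.Tf 0 0 + n - 1).choose n : ℕ)) : ℝ)) *
      (((2 * ⌈(∑ j, P.σ j * P.A j) / P.wl 0⌉₊ + 1 : ℕ) : ℝ)) * (P.N : ℝ) ^ n ≤
      2 * (((P.X : ℝ) + 3) * ((16 * exp 1 * P.L) ^ n * (exp 1 * (10 / 7)) / (5 / 2))) * ((K n : ℝ) + 2) * (P.N : ℝ) ^ n := by
    gcongr
  have e2 : 2 * (((P.X : ℝ) + 3) * ((16 * exp 1 * P.L) ^ n * (exp 1 * (10 / 7)) / (5 / 2))) * ((K n : ℝ) + 2) * (P.N : ℝ) ^ n =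
      (2 * ((P.X : ℝ) + 3) * (exp 1 * (10 / 7) / (5 / 2)) * (K n + 2)) * ((16 * exp 1 * P.L) ^ n * (P.N : ℝ) ^ n) := by ring
  have h3 : (2 * ((P.X : ℝ) + 3) * (exp 1 * (10 / 7) / (5 / 2)) * (K n + 2)) * ((16 * exp 1 * P.L) ^ n * (P.N : ℝ) ^ n) ≤
      (6 * P.X * K n) * ((16 * exp 1 * P.L) ^ n * (P.N : ℝ) ^ n) := mul_le_mul_of_nonneg_right hmid (by positivity)
  have e4 : (6 * P.X * K n) * ((16 * exp 1 * P.L) ^ n * (P.N : ℝ) ^ n) = 6 * P.X * K n * (16 * exp 1 * P.L) ^ n * (P.N : ℝ) ^ n := by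
    ring
  have hmain := h1.trans (le_of_eq e2 |>.trans (h3.trans (le_of_eq e4 |>.trans hR)))
  exact_mod_cast hmain

end ArchG3Rec

end Summit.ABC.StewartYu

end
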